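import Literature.Analysis.FluidPDE.DoeringFoiasProofs
import Literature.Analysis.FluidPDE.DoeringFoiasPowerProofs
import Literature.Analysis.FluidPDE.TorusClassicalLerayHopfProofs
import Literature.Analysis.FluidPDE.GalerkinEnergyBalanceLongTime
import Summits.AnomalousDissipation.AnomalousDissipation.Statement

/-!
# The zeroth law as persistence of force–flow correlation (solo soloist, blind mode)

The summit `AnomalousDissipation` (= `Literature.Turb.ZerothLaw`) asks for a FIXED smooth force `f`
and Leray–Hopf solutions `uⱼ` of `NS_{νⱼ}(f)`, `νⱼ → 0`, with bounded mean energy and a floor on the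
mean dissipation `εⱼ = ⟨νⱼ‖∇uⱼ‖²⟩`. Because the force does not depend on time, the mean injected
power `⟨f·uⱼ⟩ = meanPower f uⱼ` is a LINEAR functional of the trajectory — it only sees the
(Cesàro) mean flow — and the energy balance books the whole dissipation against it. This file
records the resulting ORDER-PARAMETER READING of the summit:

* `power_floor_of_dissipation_floor`, `alignment_floor_of_zerothLaw` (necessity, Leray–Hopf):
  a zeroth-law witness keeps a uniform floor `δ > 0` under the force–flow correlation
  `⟨f·uⱼ⟩`, hence (Cauchy–Schwarz, `Torus.IsGlobalLerayHopf.meanPower_le`) an energy floor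
  `δ² ≤ ‖f‖₂² ⟨‖uⱼ‖²⟩` — from the Leray–Hopf power inequality `ε ≤ ⟨f·u⟩`
  (`DoeringFoias2002_dissipation_le_power_holds`, Cheskidov–Doering–Petrov 2007 eq. (11)).
* `classical_meanDissipation_eq_meanPower` (energy equality in the mean): for a global
  CLASSICAL solution with time-bounded energy, `⟨ν‖∇u‖²⟩ = ⟨f·u⟩` exactly (Doering–Foias 2002 §2,
  eq. (2.4)–(2.6); the Leray–Hopf class only gives `≤`).
* `zerothLaw_of_classical_power_floor` (sufficiency, classical): bounded-energy global classical
  solutions of `NS_{νⱼ}(f)`, `νⱼ → 0`, whose force–flow correlation stays `≥ δ > 0` prove the summit.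

So, up to the energy-equality gap between Leray–Hopf and classical solutions, the zeroth law for a
fixed force IS the statement that the projection of the mean flow on the force does not vanish as
`ν → 0` at bounded energy — the quantity measured in turbulent Kolmogorov flow as the persistent
mean profile `Ū cos(z/L)` with `ε = FŪ/2` and friction factor `FL/Ū² → f₀ ≈ 0.124`
(Musacchio–Boffetta, Phys. Rev. E 89 (2014) 023004, eqs. (4)–(7); Borue–Orszag, JFM 306 (1996)).
[cite: DoeringFoias2002, §2] [cite: CheskidovDoeringPetrov2006, eq. (11)]
[cite: MusacchioBoffetta2014, eqs. (4)–(7)]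
-/

open MeasureTheory Filter Topology Set
open scoped ENNReal NNReal InnerProductSpace

noncomputable section

namespace Summit.AnomalousDissipation.AnomalousDissipation.Theorems

open Literature.Analysis.FunctionSpaces Literature.Analysis.FluidPDE

/-! ### Necessity: a zeroth-law witness keeps the force–flow correlation bounded below -/

/-- **Power floor from a dissipation floor** (Leray–Hopf): `ε ≤ ⟨ν‖∇u‖²⟩ ≤ ⟨f·u⟩`, by the
Leray–Hopf power inequality (Cheskidov–Doering–Petrov 2007, eq. (11); in the tree as
`DoeringFoias2002_dissipation_le_power_holds`). [cite: CheskidovDoeringPetrov2006, eq. (11)] -/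
theorem power_floor_of_dissipation_floor {ν : ℝ} (hν : 0 < ν) {f : UnitAddTorus (Fin 3) → EuclideanSpace ℝ (Fin 3)}
    (hf : Torus.IsSmooth f) (hf0 : Torus.HasZeroMean f) {u₀ : UnitAddTorus (Fin 3) → EuclideanSpace ℝ (Fin 3)} {u : ℝ → UnitAddTorus (Fin 3) → EuclideanSpace ℝ (Fin 3)}
    (hu : Torus.IsGlobalLerayHopf ν (fun _ => f) u₀ u) {ε : ℝ} (hε : ε ≤ meanDissipation ν u) :
    ε ≤ meanPower f u :=
  hε.trans (DoeringFoias2002_dissipation_le_power_holds hν (hf.memLp 2) hf0 u₀ u hu)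

/-- **The alignment floor of a zeroth-law witness.** If the summit holds, its witness family has,
besides bounded mean energy, a uniform floor `δ > 0` under the force–flow correlation `⟨f·uⱼ⟩`
(the mean flow keeps a fixed positive projection on the force) and consequently the energy floor
`δ² ≤ ‖f‖₂² ⟨‖uⱼ‖²⟩` (Cauchy–Schwarz, `Torus.IsGlobalLerayHopf.meanPower_le`).
[cite: DoeringFoias2002, §2] -/
theorem alignment_floor_of_zerothLaw (h : _root_.AnomalousDissipation) :
    ∃ f : UnitAddTorus (Fin 3) → EuclideanSpace ℝ (Fin 3), Torus.IsSmooth f ∧ Torus.IsDivFree f ∧ Torus.HasZeroMean f ∧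
      ∃ (ν : ℕ → ℝ) (u₀ : ℕ → UnitAddTorus (Fin 3) → EuclideanSpace ℝ (Fin 3)) (u : ℕ → ℝ → UnitAddTorus (Fin 3) → EuclideanSpace ℝ (Fin 3)),
        (∀ j, 0 < ν j) ∧ Tendsto ν atTop (𝓝 0) ∧
        (∀ j, Torus.IsGlobalLerayHopf (ν j) (fun _ => f) (u₀ j) (u j)) ∧
        (∃ E : ℝ, ∀ j, meanEnergy (u j) ≤ E) ∧
        ∃ δ : ℝ, 0 < δ ∧ (∀ j, δ ≤ meanPower f (u j)) ∧
          ∀ j, δ ^ 2 ≤ (∫ x, ‖f x‖ ^ 2) * meanEnergy (u j) := by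
  obtain ⟨f, hf, hfd, hf0, ν, u₀, u, hν, hν0, hLH, hE, ε, hε, hεj⟩ := h
  refine ⟨f, hf, hfd, hf0, ν, u₀, u, hν, hν0, hLH, hE, ε, hε, fun j =>
    power_floor_of_dissipation_floor (hν j) hf hf0 (hLH j) (hεj j), fun j => ?_⟩
  have hP : ε ≤ meanPower f (u j) := power_floor_of_dissipation_floor (hν j) hf hf0 (hLH j) (hεj j)
  have hPle := Torus.IsGlobalLerayHopf.meanPower_le (hν j) hf hf0 (hLH j)
  rw [rmsVelocity_eq_sqrt_meanEnergy] at hPle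
  have h1 : ε ≤ Real.sqrt (∫ x, ‖f x‖ ^ 2) * Real.sqrt (meanEnergy (u j)) := hP.trans hPle
  have hm : 0 ≤ meanEnergy (u j) := by
    by_contra hneg
    rw [Real.sqrt_eq_zero'.2 (le_of_lt (not_le.1 hneg)), mul_zero] at h1
    linarith
  have hA : 0 ≤ Real.sqrt (∫ x, ‖f x‖ ^ 2) * Real.sqrt (meanEnergy (u j)) := by positivity
  calc ε ^ 2 ≤ (Real.sqrt (∫ x, ‖f x‖ ^ 2) * Real.sqrt (meanEnergy (u j))) ^ 2 :=
        pow_le_pow_left₀ hε.le h1 2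
    _ = (∫ x, ‖f x‖ ^ 2) * meanEnergy (u j) := by
        rw [mul_pow, Real.sq_sqrt (integral_nonneg fun x => sq_nonneg _), Real.sq_sqrt hm]

/-! ### Energy equality in the mean for classical solutions -/

/-- Cauchy–Schwarz for the `L²` pairing of two continuous fields on the torus. [folklore] -/
private theorem abs_integral_inner_le {d : Type*} [Fintype d] {a b : UnitAddTorus d → EuclideanSpace ℝ d}
    (ha : Continuous a) (hb : Continuous b) :
    |∫ x, ⟪a x, b x⟫_ℝ| ≤ Real.sqrt (∫ x, ‖a x‖ ^ 2) * Real.sqrt (∫ x, ‖b x‖ ^ 2) := by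
  have hE : Integrable (fun x => ‖a x‖ ^ 2) volume :=
    (ha.norm.pow 2).integrable_of_hasCompactSupport (HasCompactSupport.of_compactSpace _)
  have hL : Integrable (fun x => ‖b x‖ ^ 2) volume :=
    (hb.norm.pow 2).integrable_of_hasCompactSupport (HasCompactSupport.of_compactSpace _)
  rw [← Real.sqrt_mul (integral_nonneg fun x => sq_nonneg _)]
  refine abs_integral_le_integral_abs.trans ?_
  refine integral_le_sqrt_integral_mul_integral (ae_of_all _ fun x => abs_nonneg _)
    (ae_of_all _ fun x => sq_nonneg _) (ae_of_all _ fun x => sq_nonneg _)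
    (ae_of_all _ fun x => ?_) (ha.inner hb).abs.aestronglyMeasurable hE hL
  rw [← mul_pow]
  exact pow_le_pow_left₀ (abs_nonneg _) (abs_real_inner_le_norm _ _) 2

/-- **Energy equality in the mean for classical solutions.** For a global classical solution
`(u, p)` of `NS_ν(f)` on `ℝ × T^d` with a steady smooth force and time-bounded energy
(`∫‖u(t)‖² ≤ R` for `t ≥ 0`; automatic for mean-zero Leray–Hopf flows, Foias–Manley–Rosa–Temam
2001 Ch. IV (3.2)), the long-time `limsup` means of dissipation and injected power coincide:
`⟨ν‖∇u‖²⟩ = ⟨f·u⟩` (Doering–Foias 2002, §2: divide the energy equality on `[0, T]` by `T`; the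
boundary term `(E(0) − E(T))/T → 0`). [cite: DoeringFoias2002, §2] -/
theorem classical_meanDissipation_eq_meanPower {d : Type*} [Fintype d] [DecidableEq d] {ν : ℝ}
    {f : UnitAddTorus d → EuclideanSpace ℝ d} {u : ℝ → UnitAddTorus d → EuclideanSpace ℝ d}
    {p : ℝ → UnitAddTorus d → ℝ} (h : Torus.IsClassicalNSSolutionOn univ ν (fun _ => f) u p)
    (hf : Torus.IsSmooth f) (hb : ∃ R : ℝ, ∀ t, 0 ≤ t → ∫ x, ‖u t x‖ ^ 2 ≤ R) :
    meanDissipation ν u = meanPower f u := by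
  obtain ⟨R, hR⟩ := hb
  have hu := h.smooth_velocity
  have hR0 : 0 ≤ R := (integral_nonneg fun x => sq_nonneg _).trans (hR 0 le_rfl)
  -- the spectral dissipation of a smooth slice is the classical one
  have hD : (fun t => ν * (Torus.eGradNormSq (u t)).toReal) = fun t => ν * Torus.gradNormSq (u t) := by
    funext t
    rw [Torus.eGradNormSq_eq_ofReal_gradNormSq (hu.isSmooth_slice (mem_univ t)),
      ENNReal.toReal_ofReal (Torus.gradNormSq_nonneg _)]
  set P : ℝ → ℝ := fun t => ∫ x, ⟪f x, u t x⟫_ℝ with hPdef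
  set r : ℝ → ℝ := fun T => T⁻¹ * (Torus.kineticEnergy (u 0) - Torus.kineticEnergy (u T)) with hrdef
  -- energy equality on `[0, T]`, divided by `T`
  have hmean : ∀ T, 0 < T → timeMean (fun t => ν * Torus.gradNormSq (u t)) T = timeMean P T + r T := by
    intro T hT
    have hE := h.energy_eq convex_univ hT.le (subset_univ _)
    simp only [timeMean, hrdef, hPdef]
    rw [intervalIntegral.integral_const_mul, ← mul_add]
    congr 1
    linarith
  -- the boundary term tends to zero
  have hKE : ∀ T, 0 ≤ T → |Torus.kineticEnergy (u 0) - Torus.kineticEnergy (u T)| ≤ R := by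
    intro T hT
    have h0 : Torus.kineticEnergy (u 0) ≤ 2⁻¹ * R := by
      unfold Torus.kineticEnergy; exact mul_le_mul_of_nonneg_left (hR 0 le_rfl) (by norm_num)
    have h0' : 0 ≤ Torus.kineticEnergy (u 0) := Torus.kineticEnergy_nonneg _
    have hT1 : Torus.kineticEnergy (u T) ≤ 2⁻¹ * R := by
      unfold Torus.kineticEnergy; exact mul_le_mul_of_nonneg_left (hR T hT) (by norm_num)
    have hT' : 0 ≤ Torus.kineticEnergy (u T) := Torus.kineticEnergy_nonneg _
    rw [abs_le]; constructor <;> linarith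
  have hr : Tendsto r atTop (𝓝 0) := by
    have h0 : Tendsto (fun T : ℝ => T⁻¹ * R) atTop (𝓝 0) := by
      simpa using tendsto_inv_atTop_zero.mul_const R
    refine squeeze_zero_norm' ?_ h0
    filter_upwards [eventually_gt_atTop (0 : ℝ)] with T hT
    rw [hrdef, Real.norm_eq_abs, abs_mul, abs_of_pos (inv_pos.2 hT)]
    exact mul_le_mul_of_nonneg_left (hKE T hT.le) (inv_nonneg.2 hT.le)
  -- the power means are bounded: `|P t| ≤ ‖f‖₂ √R`
  set M : ℝ := Real.sqrt (∫ x, ‖f x‖ ^ 2) * Real.sqrt R with hM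
  have hPt : ∀ t, 0 ≤ t → |P t| ≤ M := by
    intro t ht
    refine (abs_integral_inner_le hf.continuous (hu.isSmooth_slice (mem_univ t)).continuous).trans ?_
    exact mul_le_mul_of_nonneg_left (Real.sqrt_le_sqrt (hR t ht)) (Real.sqrt_nonneg _)
  have hPT : ∀ T, 0 < T → |timeMean P T| ≤ M := by
    intro T hT
    have hI : ‖∫ t in (0 : ℝ)..T, P t‖ ≤ M * |T - 0| :=
      intervalIntegral.norm_integral_le_of_norm_le_const fun t ht => by
        rw [uIoc_of_le hT.le] at ht
        rw [Real.norm_eq_abs]; exact hPt t ht.1.le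
    rw [sub_zero, abs_of_pos hT, Real.norm_eq_abs] at hI
    simp only [timeMean]
    rw [abs_mul, abs_of_pos (inv_pos.2 hT)]
    calc T⁻¹ * |∫ t in (0 : ℝ)..T, P t| ≤ T⁻¹ * (M * T) :=
          mul_le_mul_of_nonneg_left hI (inv_nonneg.2 hT.le)
      _ = M := by field_simp
  have hPa : IsBoundedUnder (· ≤ ·) atTop (timeMean P) :=
    ⟨M, eventually_map.2 <| (eventually_gt_atTop 0).mono fun T hT => (le_abs_self _).trans (hPT T hT)⟩
  have hPb : IsBoundedUnder (· ≥ ·) atTop (timeMean P) :=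
    ⟨-M, eventually_map.2 <| (eventually_gt_atTop 0).mono fun T hT => (abs_le.1 (hPT T hT)).1⟩
  -- conclude
  have hcongr : timeMean (fun t => ν * Torus.gradNormSq (u t)) =ᶠ[atTop] fun T => timeMean P T + r T :=
    (eventually_gt_atTop 0).mono fun T hT => hmean T hT
  show longTimeAvgSup _ = longTimeAvgSup _
  unfold longTimeAvgSup
  rw [hD, limsup_congr hcongr, limsup_add_eq_of_tendsto_zero hr hPa hPb]

/-! ### Sufficiency: classical bounded-energy families with a correlation floor prove the summit -/

/-- **The zeroth law from a force–flow correlation floor** (classical reading of the summit).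
Let `f` be smooth, divergence-free and mean-zero on `T³`, `νⱼ > 0`, `νⱼ → 0`, and let `(uⱼ, pⱼ)`
be global classical solutions of `NS_{νⱼ}(f)` with time-bounded energies, uniformly bounded mean
energy `⟨‖uⱼ‖²⟩ ≤ E`, and a uniform floor `δ ≤ ⟨f·uⱼ⟩` under the force–flow correlation (the
mean flow keeps a fixed positive projection on `f`). Then `AnomalousDissipation` holds, with
`εⱼ = ⟨f·uⱼ⟩ ≥ δ` (`classical_meanDissipation_eq_meanPower`; classical solutions are global
Leray–Hopf solutions, `Torus.IsClassicalNSSolutionOn.isGlobalLerayHopf`). With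
`alignment_floor_of_zerothLaw`: modulo the Leray–Hopf/classical energy-equality gap, the zeroth
law for a fixed force is exactly the persistence, as `ν → 0` at bounded energy, of the order
parameter `⟨f·u⟩` — in Kolmogorov flow the mean-profile amplitude `Ū` (`ε = FŪ/2`,
Musacchio–Boffetta 2014 eq. (6)). [cite: DoeringFoias2002, §2] [cite: MusacchioBoffetta2014, eqs. (4)–(7)] -/
theorem zerothLaw_of_classical_power_floor (f : UnitAddTorus (Fin 3) → EuclideanSpace ℝ (Fin 3)) (hf : Torus.IsSmooth f)
    (hfd : Torus.IsDivFree f) (hf0 : Torus.HasZeroMean f) (ν : ℕ → ℝ) (u : ℕ → ℝ → UnitAddTorus (Fin 3) → EuclideanSpace ℝ (Fin 3))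
    (p : ℕ → ℝ → UnitAddTorus (Fin 3) → ℝ) (hν : ∀ j, 0 < ν j) (hν0 : Tendsto ν atTop (𝓝 0))
    (hsol : ∀ j, Torus.IsClassicalNSSolutionOn univ (ν j) (fun _ => f) (u j) (p j))
    (hbdd : ∀ j, ∃ R : ℝ, ∀ t, 0 ≤ t → ∫ x, ‖u j t x‖ ^ 2 ≤ R)
    (hE : ∃ E : ℝ, ∀ j, meanEnergy (u j) ≤ E) (hP : ∃ δ : ℝ, 0 < δ ∧ ∀ j, δ ≤ meanPower f (u j)) :
    _root_.AnomalousDissipation := by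
  obtain ⟨δ, hδ, hδj⟩ := hP
  refine ⟨f, hf, hfd, hf0, ν, fun j => u j 0, u, hν, hν0, fun j => (hsol j).isGlobalLerayHopf, hE,
    δ, hδ, fun j => ?_⟩
  rw [classical_meanDissipation_eq_meanPower (hsol j) hf (hbdd j)]
  exact hδj j

end Summit.AnomalousDissipation.AnomalousDissipation.Theorems

end
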